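import Literature.NumberTheory.Automorphic.BrandtMatrixClassFunction
import Literature.NumberTheory.Automorphic.BrandtMatrixOne
import HarnessLib

/-!
# Column sums of Brandt matrices count the invertible sub-ideals of index `n²`

Topic `NumberTheory/Automorphic`; theorems only (no definition, no named fact, no instance).
A brick of the Brandt-module side of Pollack–Weston 2011, Thm. 6.8 (identification (iv) of
`PollackWestonCongruence.lean`). For the tree's Brandt matrices (`Brandt.matrix`,
`T(n)_ij = #{M ⊆ I_j : [I_j : M] = n², M = α I_i}`) the `j`-th column sum is

  `Σ_i T(n)_ij = #{M ⊆ I_j : [I_j : M] = n², M an invertible right O-ideal}`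

(grouping the invertible sub-ideals of `I_j` by their class; each lies in exactly one class).
This is the quantity `c(A)` of Vignéras III §5 Ex. 5.8 (a) ("la somme des colonnes de `P(A)` est
la même pour toutes les colonnes", mirrored to right ideals) and Eichler's "number of integral
ideals of norm `n`"; its independence of `j` and its value (`∏ (p^{e+1} - 1)/(p - 1)` at
`p ∤ D N`, (b) loc. cit.) are the arithmetic part and are NOT proved here. The only hypothesis
is the stability of `Brandt.rightIdeals O` under left translation by units (automatic in
division algebras, `BrandtModuleDictionary.lean`).

* `Brandt.mem_rightIdeals_iff_exists_class` — an invertible right ideal is a translate of the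
  representative of its class, and conversely;
* `Brandt.sum_matrix_eq_ncard` — the displayed identity.

## References

* M.-F. Vignéras, *Arithmétique des algèbres de quaternions*, LNM 800 (1980), Ch. III §5
  exercice 5.8 (a)–(b) [VignerasLNM800].
* M. Eichler, LNM 320 (1973), Ch. II §6 [Eichler1973].
-/

noncomputable section

open scoped Pointwise

universe u

namespace Literature.NumberTheory.Automorphic

namespace Brandt

variable {D : Type u} [Ring D]

/-- An invertible right `O`-ideal is a unit translate of the representative of some (its) class,
and conversely when `Brandt.rightIdeals O` is stable under unit translates. [folklore] -/
theorem mem_rightIdeals_iff_exists_class {O : Submodule ℤ D}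
    (hcl : ∀ I ∈ rightIdeals O, ∀ β : Dˣ, β • I ∈ rightIdeals O) (L : Submodule ℤ D) :
    L ∈ rightIdeals O ↔ ∃ (k : ClassSet O) (β : Dˣ), L = β • k.rep := by
  constructor
  · intro hmem
    obtain ⟨β, hβ⟩ := exists_rep_mk_eq_smul (⟨L, hmem⟩ : rightIdeals O)
    exact ⟨Quotient.mk (rightClassSetoid O) ⟨L, hmem⟩, β⁻¹, by rw [hβ, inv_smul_smul]⟩
  · rintro ⟨k, β, rfl⟩
    exact hcl _ k.rep_mem β

/-- Distinct classes have disjoint Brandt sets inside `I_j` (a lattice `β I_k = β' I_{k'}` forces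
`k = k'`). [folklore] -/
theorem disjoint_brandtSet_of_ne {O : Submodule ℤ D} (j : ClassSet O) (n : ℕ) {k k' : ClassSet O}
    (hkk' : k ≠ k') :
    Disjoint {L : Submodule ℤ D | L ≤ j.rep ∧ L.toAddSubgroup.relIndex j.rep.toAddSubgroup = n ^ 2 ∧
        ∃ β : Dˣ, L = β • k.rep}
      {L : Submodule ℤ D | L ≤ j.rep ∧ L.toAddSubgroup.relIndex j.rep.toAddSubgroup = n ^ 2 ∧
        ∃ β : Dˣ, L = β • k'.rep} := by
  rw [Set.disjoint_left]
  rintro L ⟨-, -, β, hβ⟩ ⟨-, -, β', hβ'⟩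
  apply hkk'
  have h : k'.rep = (β'⁻¹ * β) • k.rep := by rw [mul_smul, ← hβ, hβ', inv_smul_smul]
  exact ClassSet.eq_of_rep_eq_smul h

/-- **Column sums of Brandt matrices: `Σ_i T(n)_ij = #{M ⊆ I_j : [I_j : M] = n², M invertible}`**
(`n ≠ 0`, `D` additively torsion-free; Vignéras III §5 Ex. 5.8 (a), the number `c(A)` of
integral invertible sub-ideals of norm `n · nrd I_j`). [cite: VignerasLNM800, Ch. III §5 exercice 5.8 (a)] -/
theorem sum_matrix_eq_ncard [IsAddTorsionFree D] {O : Submodule ℤ D} [Fintype (ClassSet O)]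
    (hcl : ∀ I ∈ rightIdeals O, ∀ β : Dˣ, β • I ∈ rightIdeals O) {n : ℕ} (hn : n ≠ 0)
    (j : ClassSet O) :
    ∑ i, matrix O n i j =
      ({M : Submodule ℤ D | M ≤ j.rep ∧ M.toAddSubgroup.relIndex j.rep.toAddSubgroup = n ^ 2 ∧
          M ∈ rightIdeals O}.ncard : ℤ) := by
  classical
  set U : Set (Submodule ℤ D) := {M | M ≤ j.rep ∧
    M.toAddSubgroup.relIndex j.rep.toAddSubgroup = n ^ 2 ∧ M ∈ rightIdeals O} with hU
  set B : ClassSet O → Set (Submodule ℤ D) := fun k => {L | L ≤ j.rep ∧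
    L.toAddSubgroup.relIndex j.rep.toAddSubgroup = n ^ 2 ∧ ∃ β : Dˣ, L = β • k.rep} with hB
  have hUfin : U.Finite := finite_setOf_subideal j.rep_mem.1.1 hn _
  have hBfin : ∀ k, (B k).Finite := fun k => finite_brandtSet k j hn
  have hmemU : ∀ L, L ∈ U ↔ ∃ k, L ∈ B k := fun L => by
    constructor
    · rintro ⟨hle, hidx, hmem⟩
      obtain ⟨k, β, hβ⟩ := (mem_rightIdeals_iff_exists_class hcl L).mp hmem
      exact ⟨k, hle, hidx, β, hβ⟩
    · rintro ⟨k, hle, hidx, β, rfl⟩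
      exact ⟨hle, hidx, hcl _ k.rep_mem β⟩
  have hS : hUfin.toFinset = Finset.univ.biUnion fun k => (hBfin k).toFinset := by
    ext L
    rw [Set.Finite.mem_toFinset, hmemU, Finset.mem_biUnion]
    simp only [Finset.mem_univ, true_and, Set.Finite.mem_toFinset]
  have hpd : (↑(Finset.univ : Finset (ClassSet O)) : Set (ClassSet O)).PairwiseDisjoint
      fun k => (hBfin k).toFinset := fun k _ k' _ hkk' =>
    Set.Finite.disjoint_toFinset.mpr (disjoint_brandtSet_of_ne j n hkk')
  rw [Set.ncard_eq_toFinset_card U hUfin, hS, Finset.card_biUnion hpd]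
  push_cast
  refine Finset.sum_congr rfl fun k _ => ?_
  rw [matrix, Matrix.of_apply, Set.ncard_eq_toFinset_card _ (hBfin k)]

end Brandt

end Literature.NumberTheory.Automorphic

end
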